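import Summits.QuantumFields.YangMills.Theorems.BalabanUVNodesN14LawChannelTunedPath
import Mathlib.Analysis.SpecialFunctions.Trigonometric.Series
import Mathlib.Analysis.Complex.ExponentialBounds

/-!
# DAG node N14 (NE1′) — LENS control CARD 11, K11c′: a DECIDED ONE-SPIN INHABITANT of the tuned-path package with a
# NON-TRIVIAL defect (referee ref-K READ-35 A2 on p524273 answered)

Cell `pub-ymgap`, seat `pub-ymgap-dag-n14-c` (R134 (a) N14 NE1′ s1), generation 9; `--kind proof --supports stmt-QuantumFields-20509 --as helper`
(K3⁶ `SpineGivenEndpointR13SepCoPR`; helper, NOT a discharge).  Imports `…N14LawChannelTunedPath` (p520761 ∕ v1.1 p524273) + two Mathlib leaves.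

WHY.  Referee ref-K g2 READ-35 (card `pub-ymgap-dag-ref-K/READS/n14c-p524273.md` §6, A2): «`∃ κ κ′` is inhabited by the implicit-function construction
whenever the hypothesis package holds (that is the content); the package's joint satisfiability with a NON-TRIVIAL defect `D ≠ 0` and a genuinely positive
response is NOT EXHIBITED in Lean (E2 exhibits the degenerate `D ≡ 0` case …)».  This file EXHIBITS it: every hypothesis of
`YMDAG.N14.LawChannelTunedPath.exists_tuned_path_affine_of_detuning` is DISCHARGED on the uniform one-spin law, with a defect that MOVES the
renormalisation observable (`r₁ = tanh c ≠ 0 = r₀`) and a counterterm that is PROVABLY NOT the zero curve.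

THE TOY [decided].  `Ω = Bool`, `μ = ½·count` (uniform), spin `σ b = ±1`; source `F = σ` at `s = 0`; renormalisation observable `R = σ`; counterterm
direction `S = σ`; defect `D = c·σ`, `0 < c ≤ 1∕20`; window `V = 1`; response floor `γ = (cosh (c+1))⁻²`.
* §1 [folklore; explicit two-point computation] `integral_uniform_bool`, `isProbabilityMeasure_uniform_bool`, `integral_spin_tilted`
  (`∫ σ dμ.tilted(a·σ) = tanh a`), `cov_spin_tilted` (`cov[σ, σ; μ.tilted(a·σ)] = 1 − tanh² a`), private `one_sub_tanh_sq` (`= (cosh a)⁻²`; the tree has the same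
  one-liner in `Literature/Probability/RandomMatrix/TwoQubitSeparabilityVolumesRebitHolds` — kept private here rather than importing a random-matrix leaf).
* §2 [folklore] the strip letters: `inv_cosh_sq_le_cov_spin` (response floor on `|a| ≤ c + 1`), private `exp_two_lt_nine`, `two_mul_le_inv_cosh_sq`
  (`2c ≤ (cosh (c+1))⁻²` for `0 ≤ c ≤ 1∕20`, via Mathlib's `Real.cosh_le_exp_half_sq` and `Real.exp_one_lt_d9`).
* §3 the package DISCHARGED: `toy_endpoint_zero` ∕ `toy_endpoint_one` (`r₀ = 0`, `r₁ = tanh c`), `toy_response` (`γ ≤ Cov_{u,v}(R,S)` on `[0,1] × [−1,1]`),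
  `toy_detuning` (`|∫ R dμ.tilted(u·D) − u·tanh c| ≤ 2c ≤ γ·V` — derived FROM THE PACKAGE's own response calculus `hasDerivAt_integral_chord_u` and the
  mean-value inequality, no `tanh ≤ id` lemma), ★ `toy_tunedPath_affine` (= `exists_tuned_path_affine_of_detuning` APPLIED, all ten hypotheses supplied:
  `∃ κ κ′` C¹, `κ 0 = κ 1 = 0`, `κ([0,1]) ⊆ [−1,1]`, `∫ σ dμ.tilted(0·σ + u·(c·σ) + κ(u)·σ) = (1−u)·0 + u·tanh c` on `[0,1]`).
* §4 NON-DEGENERACY [decided]: private `tanh_pos_of_pos` (tree homonyms in `KramersWannierDuality` ∕ `ComplexConeContractionThm23`, not imported), `half_tanh_lt_tanh_half` (`½·tanh c < tanh (c∕2)` for `c > 0` — strict concavity in one line of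
  double-angle algebra), `toy_defect_ne_zero` (`D ≠ 0`, `r₁ ≠ r₀`), ★ `toy_counterterm_ne_zero` (ANY counterterm holding the affine target has `κ(½) ≠ 0`:
  the tuned path is NOT the straight chord), ★★ `toy_tunedPath_nondegenerate` (the exhibit in one sentence: the package holds with `D ≠ 0`, `r₁ ≠ r₀`,
  and every `κ` it produces is non-zero at `u = ½`).

HONEST FRAMING.  A decided toy answering a referee's vacuity question (A2) about a hypothesis package; [folklore] two-point calculus; NOTHING of
Bałaban's; the producer inputs of CARD 11 at the record (response, detuning, window for the history-conditioned class laws) remain UNSUPPLIED (NODE O);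
N14 ∕ N19 NOT discharged; K3⁶ NOT claimed; count-neutral.  One finite T⁴ programme at fixed ε — NOT continuum ∕ ℝ⁴ ∕ OS ∕ mass gap ∕ Clay.
-/

noncomputable section

namespace YMDAG.N14.LawChannelTunedPathToy

open MeasureTheory ProbabilityTheory Set Filter Topology
open scoped ENNReal
open YMDAG.N14.LawChannelTunedPath (exists_tuned_path_affine_of_detuning hasDerivAt_integral_chord_u)

/-! ## §1 The uniform one-spin law and its tilts -/
section Spin

/-- Integration against the uniform law on `Bool`: the average of the two values. [folklore] -/
theorem integral_uniform_bool (f : Bool → ℝ) :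
    ∫ b, f b ∂((2 : ℝ≥0∞)⁻¹ • (Measure.count : Measure Bool)) = 2⁻¹ * (f true + f false) := by
  rw [integral_smul_measure, integral_count, ENNReal.toReal_inv]
  simp only [Fintype.sum_bool, smul_eq_mul]
  norm_num

/-- The uniform law on `Bool` is a probability measure. [folklore] -/
theorem isProbabilityMeasure_uniform_bool :
    IsProbabilityMeasure ((2 : ℝ≥0∞)⁻¹ • (Measure.count : Measure Bool)) := by
  constructor
  rw [Measure.smul_apply, smul_eq_mul, ← Finset.coe_univ, Measure.count_apply_finset]
  simp only [Finset.card_univ, Fintype.card_bool]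
  norm_num
  exact ENNReal.inv_mul_cancel (by norm_num) (by norm_num)

/-- **THE TILTED ONE-SPIN MEAN** [folklore; two-point computation]: under the uniform law tilted by `a·σ` the spin has mean
`(e^{a} − e^{−a})∕(e^{a} + e^{−a}) = tanh a`. -/
theorem integral_spin_tilted (a : ℝ) :
    ∫ b, (if b then (1 : ℝ) else -1)
      ∂(((2 : ℝ≥0∞)⁻¹ • (Measure.count : Measure Bool)).tilted fun b => a * (if b then (1 : ℝ) else -1)) = Real.tanh a := by
  rw [integral_tilted, integral_uniform_bool, integral_uniform_bool]
  simp only [Bool.false_eq_true, if_true, if_false, mul_one, mul_neg_one, smul_eq_mul]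
  rw [Real.tanh_eq]
  have hpos : 0 < Real.exp a + Real.exp (-a) := by positivity
  field_simp
  ring

/-- **THE TILTED ONE-SPIN COVARIANCE** [folklore]: `cov[σ, σ; μ.tilted(a·σ)] = 1 − tanh² a` (`σ² ≡ 1`). -/
theorem cov_spin_tilted (a : ℝ) :
    cov[(fun b : Bool => if b then (1 : ℝ) else -1), (fun b : Bool => if b then (1 : ℝ) else -1);
      ((2 : ℝ≥0∞)⁻¹ • (Measure.count : Measure Bool)).tilted fun b => a * (if b then (1 : ℝ) else -1)] = 1 - Real.tanh a ^ 2 := by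
  set μ : Measure Bool := (2 : ℝ≥0∞)⁻¹ • Measure.count with hμ
  set σ : Bool → ℝ := fun b => if b then (1 : ℝ) else -1 with hσ
  haveI : IsProbabilityMeasure μ := isProbabilityMeasure_uniform_bool
  have hint : Integrable (fun b => Real.exp (a * σ b)) μ := Integrable.of_finite
  haveI : IsProbabilityMeasure (μ.tilted fun b => a * σ b) := isProbabilityMeasure_tilted hint
  have hσm : Measurable σ := measurable_of_countable σ
  have hσb : ∀ᵐ b ∂(μ.tilted fun b => a * σ b), ‖σ b‖ ≤ 1 := ae_of_all _ fun b => by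
    rw [Real.norm_eq_abs, hσ]; cases b <;> simp
  have hmem : MemLp σ 2 (μ.tilted fun b => a * σ b) := MemLp.of_bound hσm.aestronglyMeasurable 1 hσb
  rw [covariance_eq_sub hmem hmem]
  have hsq : (σ * σ) = fun _ => (1 : ℝ) := by funext b; rw [Pi.mul_apply, hσ]; cases b <;> simp
  rw [hsq, integral_const, smul_eq_mul, mul_one]
  simp only [probReal_univ]
  rw [hμ, hσ, integral_spin_tilted a]
  ring

/-- `1 − tanh² a = (cosh a)⁻²` (`cosh² − sinh² = 1`). [folklore] -/
private theorem one_sub_tanh_sq (a : ℝ) : 1 - Real.tanh a ^ 2 = (Real.cosh a ^ 2)⁻¹ := by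
  have hc : Real.cosh a ≠ 0 := (Real.cosh_pos a).ne'
  rw [Real.tanh_eq_sinh_div_cosh, div_pow]
  have h := Real.cosh_sq_sub_sinh_sq a
  field_simp
  linarith

end Spin

/-! ## §2 The strip letters -/
section Strip

/-- **RESPONSE FLOOR ON THE STRIP** [folklore]: for `|a| ≤ M`, `(cosh M)⁻² ≤ cov[σ, σ; μ.tilted(a·σ)]` (`cosh` is even and increasing in `|·|`). -/
theorem inv_cosh_sq_le_cov_spin {a M : ℝ} (ha : |a| ≤ M) :
    (Real.cosh M ^ 2)⁻¹ ≤ cov[(fun b : Bool => if b then (1 : ℝ) else -1), (fun b : Bool => if b then (1 : ℝ) else -1);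
      ((2 : ℝ≥0∞)⁻¹ • (Measure.count : Measure Bool)).tilted fun b => a * (if b then (1 : ℝ) else -1)] := by
  rw [cov_spin_tilted, one_sub_tanh_sq]
  have hM : |a| ≤ |M| := ha.trans (le_abs_self M)
  have hcosh : Real.cosh a ≤ Real.cosh M := Real.cosh_le_cosh.2 hM
  have ha0 : 0 < Real.cosh a := Real.cosh_pos a
  have hsq : Real.cosh a ^ 2 ≤ Real.cosh M ^ 2 := pow_le_pow_left₀ ha0.le hcosh 2
  exact inv_anti₀ (by positivity) hsq

/-- `e² < 9` (from Mathlib's `exp 1 < 2.7182818286`). [folklore] -/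
private theorem exp_two_lt_nine : Real.exp 2 < 9 := by
  have h1 := Real.exp_one_lt_d9
  have h0 : 0 < Real.exp 1 := Real.exp_pos 1
  rw [show (2 : ℝ) = 1 + 1 by norm_num, Real.exp_add]
  nlinarith

/-- **THE WINDOW REACHES** [folklore]: for `0 ≤ c ≤ 1∕20`, `2c ≤ (cosh (c+1))⁻²` — via `cosh x ≤ e^{x²∕2}` (Mathlib `Real.cosh_le_exp_half_sq`),
`(c+1)² ≤ 2` and `e² < 9`. -/
theorem two_mul_le_inv_cosh_sq {c : ℝ} (hc0 : 0 ≤ c) (hc : c ≤ 1 / 20) : 2 * c ≤ (Real.cosh (c + 1) ^ 2)⁻¹ := by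
  have hsq : (c + 1) ^ 2 ≤ 2 := by nlinarith
  have hcosh : Real.cosh (c + 1) ≤ Real.exp ((c + 1) ^ 2 / 2) := Real.cosh_le_exp_half_sq (c + 1)
  have hcosh0 : 0 < Real.cosh (c + 1) := Real.cosh_pos _
  have hc2 : Real.cosh (c + 1) ^ 2 ≤ Real.exp ((c + 1) ^ 2) := by
    calc Real.cosh (c + 1) ^ 2 ≤ Real.exp ((c + 1) ^ 2 / 2) ^ 2 := pow_le_pow_left₀ hcosh0.le hcosh 2
      _ = Real.exp ((c + 1) ^ 2) := by rw [← Real.exp_nat_mul]; ring_nf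
  have hc3 : Real.exp ((c + 1) ^ 2) ≤ Real.exp 2 := Real.exp_le_exp.2 hsq
  have h9 : Real.cosh (c + 1) ^ 2 < 9 := lt_of_le_of_lt (hc2.trans hc3) exp_two_lt_nine
  have hpos : 0 < Real.cosh (c + 1) ^ 2 := by positivity
  calc 2 * c ≤ 9⁻¹ := by linarith
    _ ≤ (Real.cosh (c + 1) ^ 2)⁻¹ := inv_anti₀ hpos h9.le

end Strip

/-! ## §3 The package DISCHARGED on the one-spin law -/
section Package

/-- `r₀ = 0`: at zero tilt the spin has mean zero. [folklore] -/
theorem toy_endpoint_zero :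
    ∫ b, (if b then (1 : ℝ) else -1)
      ∂(((2 : ℝ≥0∞)⁻¹ • (Measure.count : Measure Bool)).tilted fun b => (0 : ℝ) * (if b then (1 : ℝ) else -1)) = 0 := by
  rw [integral_spin_tilted, Real.tanh_zero]

/-- `r₁ = tanh c`: after the defect `D = c·σ` the spin has mean `tanh c`. [folklore] -/
theorem toy_endpoint_one (c : ℝ) :
    ∫ b, (if b then (1 : ℝ) else -1)
      ∂(((2 : ℝ≥0∞)⁻¹ • (Measure.count : Measure Bool)).tilted fun b =>
        (0 : ℝ) * (if b then (1 : ℝ) else -1) + c * (if b then (1 : ℝ) else -1)) = Real.tanh c := by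
  have e : (fun b : Bool => (0 : ℝ) * (if b then (1 : ℝ) else -1) + c * (if b then (1 : ℝ) else -1)) =
      fun b => c * (if b then (1 : ℝ) else -1) := by funext b; ring
  rw [e, integral_spin_tilted]

/-- **RESPONSE** `γ ≤ Cov_{u,v}(R, S)` on `[0,1] × [−1, 1]` with `γ = (cosh (c+1))⁻²`, for `0 ≤ c`. [folklore] -/
theorem toy_response {c : ℝ} (hc0 : 0 ≤ c) :
    ∀ u ∈ Set.Icc (0 : ℝ) 1, ∀ v ∈ Set.Icc (-1 : ℝ) 1,
      (Real.cosh (c + 1) ^ 2)⁻¹ ≤ cov[(fun b : Bool => if b then (1 : ℝ) else -1), (fun b : Bool => if b then (1 : ℝ) else -1);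
        ((2 : ℝ≥0∞)⁻¹ • (Measure.count : Measure Bool)).tilted fun b =>
          (0 : ℝ) * (if b then (1 : ℝ) else -1) + u * (c * (if b then (1 : ℝ) else -1)) + v * (if b then (1 : ℝ) else -1)] := by
  intro u hu v hv
  have e : (fun b : Bool => (0 : ℝ) * (if b then (1 : ℝ) else -1) + u * (c * (if b then (1 : ℝ) else -1)) + v * (if b then (1 : ℝ) else -1)) =
      fun b => (u * c + v) * (if b then (1 : ℝ) else -1) := by funext b; ring
  rw [e]
  refine inv_cosh_sq_le_cov_spin (abs_le.2 ⟨?_, ?_⟩)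
  · nlinarith [hu.1, hv.1]
  · nlinarith [hu.2, hv.2]

/-- **DETUNING** along the straight chord: `|∫ R dμ.tilted(u·D) − ((1−u)·0 + u·tanh c)| ≤ 2c` for `0 ≤ c`, `u ∈ [0,1]` — from the PACKAGE's own
response calculus (`hasDerivAt_integral_chord_u`: `∂_u ∫ σ dμ_{u,0} = Cov_{u,0}(σ, c·σ) = c·(1 − tanh²) ∈ [0, c]`) and the mean-value inequality
(`‖f u − f 0‖ ≤ c·u`), applied at `u` and at `u = 1`. [folklore] -/
theorem toy_detuning {c : ℝ} (hc0 : 0 ≤ c) :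
    ∀ u ∈ Set.Icc (0 : ℝ) 1,
      |(∫ b, (if b then (1 : ℝ) else -1)
          ∂(((2 : ℝ≥0∞)⁻¹ • (Measure.count : Measure Bool)).tilted fun b =>
            (0 : ℝ) * (if b then (1 : ℝ) else -1) + u * (c * (if b then (1 : ℝ) else -1)))) - ((1 - u) * 0 + u * Real.tanh c)| ≤ 2 * c := by
  intro u hu
  set μ : Measure Bool := (2 : ℝ≥0∞)⁻¹ • Measure.count with hμ
  set σ : Bool → ℝ := fun b => if b then (1 : ℝ) else -1 with hσ
  haveI : IsProbabilityMeasure μ := isProbabilityMeasure_uniform_bool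
  have hσm : Measurable σ := measurable_of_countable σ
  have hσb : ∀ b, |σ b| ≤ 1 := fun b => by rw [hσ]; cases b <;> simp
  have hDm : Measurable fun b => c * σ b := measurable_of_countable _
  have hDb : ∀ b, |c * σ b| ≤ |c| * 1 := fun b => by rw [abs_mul]; exact mul_le_mul_of_nonneg_left (hσb b) (abs_nonneg c)
  -- the straight-chord mean `f t = ∫ σ dμ.tilted (0·σ + t·(cσ) + 0·σ)` and its derivative `c · Cov_{t,0}(σ, σ)`
  set f : ℝ → ℝ := fun t => ∫ b, σ b ∂(μ.tilted fun b => (0 : ℝ) * σ b + t * (c * σ b) + (0 : ℝ) * σ b) with hf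
  have hderiv : ∀ t, HasDerivAt f (cov[σ, fun b => c * σ b; μ.tilted fun b => (0 : ℝ) * σ b + t * (c * σ b) + (0 : ℝ) * σ b]) t :=
    fun t => hasDerivAt_integral_chord_u (μ := μ) (s := (0 : ℝ)) hσm hσb hσm hσb hDm hDb hσm hσb t 0
  have hcov : ∀ t, cov[σ, fun b => c * σ b; μ.tilted fun b => (0 : ℝ) * σ b + t * (c * σ b) + (0 : ℝ) * σ b] =
      c * (1 - Real.tanh (t * c) ^ 2) := fun t => by
    have e : (fun b : Bool => (0 : ℝ) * σ b + t * (c * σ b) + (0 : ℝ) * σ b) = fun b => (t * c) * σ b := by funext b; ring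
    rw [covariance_const_mul_right, e, hσ, hμ, cov_spin_tilted]
  have hbound : ∀ t ∈ Set.Ico (0 : ℝ) 1, ‖cov[σ, fun b => c * σ b; μ.tilted fun b => (0 : ℝ) * σ b + t * (c * σ b) + (0 : ℝ) * σ b]‖ ≤ c :=
    fun t _ => by
      rw [hcov, Real.norm_eq_abs]
      have h1 : 0 ≤ 1 - Real.tanh (t * c) ^ 2 := by nlinarith [Real.tanh_sq_lt_one (t * c)]
      have h2 : 1 - Real.tanh (t * c) ^ 2 ≤ 1 := by nlinarith [sq_nonneg (Real.tanh (t * c))]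
      rw [abs_of_nonneg (mul_nonneg hc0 h1)]
      nlinarith
  have hmvt := norm_image_sub_le_of_norm_deriv_le_segment' (f := f) (a := 0) (b := 1)
    (fun t _ => (hderiv t).hasDerivWithinAt) hbound
  have hf0 : f 0 = 0 := by
    have e : (fun b : Bool => (0 : ℝ) * σ b + (0 : ℝ) * (c * σ b) + (0 : ℝ) * σ b) = fun b => (0 : ℝ) * σ b := by funext b; ring
    simp only [hf, e]
    rw [hσ, hμ]; exact toy_endpoint_zero
  have hf1 : f 1 = Real.tanh c := by
    have e : (fun b : Bool => (0 : ℝ) * σ b + (1 : ℝ) * (c * σ b) + (0 : ℝ) * σ b) = fun b => c * σ b := by funext b; ring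
    simp only [hf, e]
    rw [hσ, hμ]; exact integral_spin_tilted c
  have hu' : |f u| ≤ c * u := by
    have := hmvt u hu
    rwa [hf0, sub_zero, sub_zero, Real.norm_eq_abs] at this
  have h1' : |Real.tanh c| ≤ c := by
    have := hmvt 1 ⟨zero_le_one, le_rfl⟩
    rwa [hf0, hf1, sub_zero, sub_zero, Real.norm_eq_abs, mul_one] at this
  -- the integral in the statement IS `f u` (drop the trailing `0·σ`)
  have hfu : (∫ b, σ b ∂(μ.tilted fun b => (0 : ℝ) * σ b + u * (c * σ b))) = f u := by
    have e : (fun b : Bool => (0 : ℝ) * σ b + u * (c * σ b) + (0 : ℝ) * σ b) = fun b => (0 : ℝ) * σ b + u * (c * σ b) := by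
      funext b; ring
    simp only [hf, e]
  rw [hfu]
  have hu0 : 0 ≤ u := hu.1
  have hu1 : u ≤ 1 := hu.2
  calc |f u - ((1 - u) * 0 + u * Real.tanh c)| = |f u - u * Real.tanh c| := by ring_nf
    _ ≤ |f u| + |u * Real.tanh c| := abs_sub _ _
    _ = |f u| + u * |Real.tanh c| := by rw [abs_mul, abs_of_nonneg hu0]
    _ ≤ c * u + u * c := add_le_add hu' (mul_le_mul_of_nonneg_left h1' hu0)
    _ ≤ 2 * c := by nlinarith

/-- ★ **THE PACKAGE INHABITED WITH A NON-TRIVIAL DEFECT** — `exists_tuned_path_affine_of_detuning` APPLIED on the one-spin law with `R = S = F = σ`,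
`s = 0`, `D = c·σ`, `0 < c ≤ 1∕20`, `V = 1`, `γ = (cosh (c+1))⁻²`, `r₀ = 0`, `r₁ = tanh c`; all ten hypotheses supplied by §§1–3.  Conclusion VERBATIM in the
package's letters. [folklore ∘ `exists_tuned_path_affine_of_detuning`] -/
theorem toy_tunedPath_affine {c : ℝ} (hc : 0 < c) (hc' : c ≤ 1 / 20) :
    ∃ κ κ' : ℝ → ℝ, (∀ u, HasDerivAt κ (κ' u) u) ∧ Continuous κ' ∧ κ 0 = 0 ∧ κ 1 = 0 ∧
      (∀ u ∈ Set.Icc (0 : ℝ) 1, κ u ∈ Set.Icc (-1 : ℝ) 1) ∧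
      ∀ u ∈ Set.Icc (0 : ℝ) 1,
        ∫ b, (if b then (1 : ℝ) else -1)
          ∂(((2 : ℝ≥0∞)⁻¹ • (Measure.count : Measure Bool)).tilted fun b =>
            (0 : ℝ) * (if b then (1 : ℝ) else -1) + u * (c * (if b then (1 : ℝ) else -1)) + κ u * (if b then (1 : ℝ) else -1)) =
          (1 - u) * 0 + u * Real.tanh c := by
  set μ : Measure Bool := (2 : ℝ≥0∞)⁻¹ • Measure.count with hμ
  haveI : IsProbabilityMeasure μ := isProbabilityMeasure_uniform_bool
  have hσm : Measurable fun b : Bool => if b then (1 : ℝ) else -1 := measurable_of_countable _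
  have hσb : ∀ b : Bool, |(if b then (1 : ℝ) else -1)| ≤ 1 := fun b => by cases b <;> simp
  have hDm : Measurable fun b : Bool => c * (if b then (1 : ℝ) else -1) := measurable_of_countable _
  have hDb : ∀ b : Bool, |c * (if b then (1 : ℝ) else -1)| ≤ |c| * 1 := fun b => by
    rw [abs_mul]; exact mul_le_mul_of_nonneg_left (hσb b) (abs_nonneg c)
  have hγ : 0 < (Real.cosh (c + 1) ^ 2)⁻¹ := by positivity
  refine exists_tuned_path_affine_of_detuning (μ := μ) (s := (0 : ℝ)) (r₀ := 0) (r₁ := Real.tanh c) hσm hσb hσm hσb hDm hDb hσm hσb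
    hγ one_pos ?_ ?_ ?_ ?_
  · rw [hμ]; exact toy_response hc.le
  · intro u hu
    rw [mul_one, hμ]
    exact (toy_detuning hc.le u hu).trans (two_mul_le_inv_cosh_sq hc.le hc')
  · rw [hμ]; exact toy_endpoint_zero
  · rw [hμ]; exact toy_endpoint_one c

end Package

/-! ## §4 Non-degeneracy: the defect moves the observable, and every counterterm the package produces is non-zero -/
section Nondegenerate

/-- `tanh c > 0` for `c > 0`. [folklore] -/
private theorem tanh_pos_of_pos {c : ℝ} (hc : 0 < c) : 0 < Real.tanh c := by
  rw [Real.tanh_eq_sinh_div_cosh]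
  exact div_pos (Real.sinh_pos_iff.2 hc) (Real.cosh_pos c)

/-- **STRICT CONCAVITY IN ONE LINE** [folklore]: `½·tanh c < tanh (c∕2)` for `c > 0` (double angle: `tanh c = 2·sinh(c∕2)cosh(c∕2) ∕ (cosh² + sinh²)(c∕2)`,
and `cosh² < cosh² + sinh²`). -/
theorem half_tanh_lt_tanh_half {c : ℝ} (hc : 0 < c) : Real.tanh c / 2 < Real.tanh (c / 2) := by
  have hs : 0 < Real.sinh (c / 2) := Real.sinh_pos_iff.2 (by linarith)
  have hch : 0 < Real.cosh (c / 2) := Real.cosh_pos _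
  set s := Real.sinh (c / 2) with hs_def
  set ch := Real.cosh (c / 2) with hch_def
  have h1 : Real.tanh c = 2 * s * ch / (ch ^ 2 + s ^ 2) := by
    rw [Real.tanh_eq_sinh_div_cosh, show c = 2 * (c / 2) by ring, Real.sinh_two_mul, Real.cosh_two_mul]
  have h2 : Real.tanh (c / 2) = s / ch := Real.tanh_eq_sinh_div_cosh _
  have h3 : 2 * s * ch / (ch ^ 2 + s ^ 2) < 2 * s * ch / ch ^ 2 :=
    div_lt_div_of_pos_left (by positivity) (by positivity) (by nlinarith)
  have h4 : 2 * s * ch / ch ^ 2 = 2 * (s / ch) := by field_simp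
  rw [h1, h2]
  linarith

/-- **THE DEFECT IS NON-TRIVIAL** [decided]: `D = c·σ ≠ 0` and the endpoint means differ (`r₁ = tanh c ≠ 0 = r₀`). -/
theorem toy_defect_ne_zero {c : ℝ} (hc : 0 < c) :
    (fun b : Bool => c * (if b then (1 : ℝ) else -1)) ≠ 0 ∧ Real.tanh c ≠ 0 := by
  refine ⟨fun h => ?_, (tanh_pos_of_pos hc).ne'⟩
  have := congr_fun h true
  simp only [if_true, mul_one, Pi.zero_apply] at this
  exact hc.ne' this

/-- ★ **EVERY COUNTERTERM THE PACKAGE PRODUCES IS NON-ZERO AT `u = ½`** [decided]: if `κ` holds the affine target at `u = ½`,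
`∫ σ dμ.tilted(0·σ + ½·(c·σ) + κ(½)·σ) = ½·0 + ½·tanh c`, then `κ(½) ≠ 0` — else the mean would be `tanh (c∕2) > ½·tanh c`.  The tuned path is NOT
the straight chord. -/
theorem toy_counterterm_ne_zero {c : ℝ} (hc : 0 < c) {κ : ℝ → ℝ}
    (hκ : ∫ b, (if b then (1 : ℝ) else -1)
      ∂(((2 : ℝ≥0∞)⁻¹ • (Measure.count : Measure Bool)).tilted fun b =>
        (0 : ℝ) * (if b then (1 : ℝ) else -1) + (1 / 2 : ℝ) * (c * (if b then (1 : ℝ) else -1)) + κ (1 / 2) * (if b then (1 : ℝ) else -1)) =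
      (1 - 1 / 2) * 0 + 1 / 2 * Real.tanh c) :
    κ (1 / 2) ≠ 0 := by
  intro h0
  have e : (fun b : Bool => (0 : ℝ) * (if b then (1 : ℝ) else -1) + (1 / 2 : ℝ) * (c * (if b then (1 : ℝ) else -1)) +
      κ (1 / 2) * (if b then (1 : ℝ) else -1)) = fun b => (c / 2) * (if b then (1 : ℝ) else -1) := by
    funext b; rw [h0]; ring
  rw [e, integral_spin_tilted] at hκ
  have hlt := half_tanh_lt_tanh_half hc
  have : Real.tanh (c / 2) = Real.tanh c / 2 := by rw [hκ]; ring
  linarith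

/-- ★★ **THE EXHIBIT IN ONE SENTENCE** (ref-K READ-35 A2 answered) [decided]: for every `0 < c ≤ 1∕20` the K11c′ package
(`exists_tuned_path_affine_of_detuning`: response `γ > 0` on the strip, detuning `≤ γ·V`, endpoints `r₀`, `r₁`) HOLDS on the one-spin law with the
NON-TRIVIAL defect `D = c·σ ≠ 0` and DIFFERENT endpoint means `r₁ = tanh c ≠ 0 = r₀`, and produces a C¹ counterterm `κ` in the window, vanishing at
both ends, holding the affine target on `[0,1]`, with `κ(½) ≠ 0`. -/
theorem toy_tunedPath_nondegenerate {c : ℝ} (hc : 0 < c) (hc' : c ≤ 1 / 20) :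
    (fun b : Bool => c * (if b then (1 : ℝ) else -1)) ≠ 0 ∧ Real.tanh c ≠ 0 ∧
    ∃ κ κ' : ℝ → ℝ, (∀ u, HasDerivAt κ (κ' u) u) ∧ Continuous κ' ∧ κ 0 = 0 ∧ κ 1 = 0 ∧
      (∀ u ∈ Set.Icc (0 : ℝ) 1, κ u ∈ Set.Icc (-1 : ℝ) 1) ∧
      (∀ u ∈ Set.Icc (0 : ℝ) 1,
        ∫ b, (if b then (1 : ℝ) else -1)
          ∂(((2 : ℝ≥0∞)⁻¹ • (Measure.count : Measure Bool)).tilted fun b =>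
            (0 : ℝ) * (if b then (1 : ℝ) else -1) + u * (c * (if b then (1 : ℝ) else -1)) + κ u * (if b then (1 : ℝ) else -1)) =
          (1 - u) * 0 + u * Real.tanh c) ∧
      κ (1 / 2) ≠ 0 := by
  obtain ⟨κ, κ', hd, hc1, h0, h1, hwin, htarget⟩ := toy_tunedPath_affine hc hc'
  have hhalf : (1 / 2 : ℝ) ∈ Set.Icc (0 : ℝ) 1 := ⟨by norm_num, by norm_num⟩
  exact ⟨(toy_defect_ne_zero hc).1, (toy_defect_ne_zero hc).2, κ, κ', hd, hc1, h0, h1, hwin, htarget,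
    toy_counterterm_ne_zero hc (htarget (1 / 2) hhalf)⟩

end Nondegenerate

end YMDAG.N14.LawChannelTunedPathToy

end
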